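import Summits.QuantumFields.YangMills.Theorems.UnitScaleTiltFluctuationComparisonRegPrGlobalSlackCanonicalPolymersVolume
import HarnessLib

/-!
# `UnitScaleTiltFluctuationComparisonRegPrGlobalSlackCanonicalPolymersVolumeC` — THE BLOCK-VOLUME ROW FOR THE CANONICAL POLYMERISATION WITHOUT THE
# `L ≤ M₁` LETTER (crux `FluctuationComparisonRegPrIntL`, stmt-QuantumFields-20520 — formerly 19935 —, STUB 3⁗ `stub_globalTwoRunSlackFam`; width-lever lane A,
# producer row 3; OWNER ym3-torus-plan g22 RULING №5 §C ask W-slack-1)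

Seat ym-ust-19935-slack g2 (prover).  The producer row `LocBlockVolume D` normalises a term-level-`i` localisation domain to `≥ L^{3i}` fine sites; for the
canonical polymerisation `canonPolymer p` (p533541) the NEW-term domains born at step `k` (term level `k+1`) are unions of scale-`k` big blocks of side
`M₁·L^k` (no wrap-around) or the whole torus (`S_k < M₁`), so the normalisation holds only for `L ≤ M₁` (`locBlockVolume_canon`, p534516, g0).  Here the
row is proved with the HONEST WEIGHT `volWeight L M₁ := min 1 ((M₁/L)³)` and NO condition on `M₁`:

* §1 `volWeight`, `volWeight_pos`, `volWeight_le_one`, `volWeight_mul_pow_le` (`volWeight·L^{3(k+1)} ≤ M₁³·(L^k)³`);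
* §2 `volWeight_mul_pow_le_sum_indicator_domSet` (`volWeight·L^{3(k+1)} ≤ #domSet` for every step-`k` domain, `k + 1 ≤ m + K`; g0's two cases with the
  letter replaced by the weight);
* §3 **`volWeight_mul_pow_le_sum_indicator_canon`**: for EVERY v3 family `p` and every listed level-`i` domain `Y` of `dataOfV3 p (canonPolymer p)`,
  `volWeight·L^{3i} ≤ #Y` — i.e. the `c`-weighted volume row `GlobalSlackLocalToGlobalCount.LocBlockVolumeC … (volWeight L M₁)` (stated here in raw form so that
  this file does not wait on that module; the capstone `…CanonicalEndToEndC` packs it), which the count-form producer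
  `GlobalSlackLocalToGlobalCount.globalTwoRunSlackTail_of_polymerSlack_volC` consumes at the price `(L/M₁)³ ∨ 1` in the `K`-uniform constant.
Pure lattice combinatorics; nothing of [Balaban1985UV3] is asserted.

References: T. Bałaban, CMP 102 (1985) 255–275 [Balaban1985UV3] ((24) p.262, (39) p.266, (59) p.270); CMP 109 (1987) 249–301 [Balaban1987RG1] ((0.1)–(0.3) pp.251–252).
-/

set_option autoImplicit false

noncomputable section

namespace Summit.QuantumFields.YangMills.Theorems.GlobalSlackCanonicalPolymers

open scoped BigOperators
open Finset
open Literature.MathematicalPhysics.QuantumFieldTheory.Balaban1983to89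
open Literature.MathematicalPhysics.QuantumFieldTheory.Balaban1983to89.T3ContinuumYM3Torus
open Literature.MathematicalPhysics.QuantumFieldTheory.Balaban1983to89.T3AlphaInputsAC
open Literature.MathematicalPhysics.QuantumFieldTheory.Balaban1983to89.T3AlphaInputsACTwoRunLevel
open Literature.MathematicalPhysics.QuantumFieldTheory.Balaban1983to89.TreeLengthTorus (tsys)
open Literature.MathematicalPhysics.QuantumFieldTheory.Balaban1985CMP102
open Literature.MathematicalPhysics.QuantumFieldTheory.Balaban1985CMP102.Setting
open Summit.QuantumFields.Balaban3D.Carriers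
open Summit.QuantumFields.Balaban3D.Proofs.Primitives
open Summit.QuantumFields.YangMills.Theorems

variable {F : T3Family}

/-! ## §1 The honest volume weight `min 1 (M₁/L)³` -/

/-- **THE VOLUME WEIGHT** `min 1 ((M₁/L)³)`: the fraction of a level-`(k+1)` block a scale-`k` big block is guaranteed to fill. [cite: Balaban1985UV3, (24) p.262] -/
def volWeight (L M₁ : ℕ) : ℝ := min 1 (((M₁ : ℝ) / L) ^ 3)

/-- The volume weight is positive for `0 < L`, `0 < M₁`. [cite: Balaban1985UV3, (24) p.262] -/
theorem volWeight_pos {L M₁ : ℕ} (hL : 0 < L) (hM : 0 < M₁) : 0 < volWeight L M₁ := by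
  unfold volWeight
  have hL' : (0 : ℝ) < L := by exact_mod_cast hL
  have hM' : (0 : ℝ) < M₁ := by exact_mod_cast hM
  exact lt_min one_pos (by positivity)

/-- The volume weight is at most `1`. [cite: Balaban1985UV3, (24) p.262] -/
theorem volWeight_le_one (L M₁ : ℕ) : volWeight L M₁ ≤ 1 := min_le_left _ _

/-- The volume weight is at most `(M₁/L)³`. [cite: Balaban1985UV3, (24) p.262] -/
theorem volWeight_le_ratio (L M₁ : ℕ) : volWeight L M₁ ≤ ((M₁ : ℝ) / L) ^ 3 := min_le_right _ _

/-- **`volWeight·L^{3(k+1)} ≤ M₁³·(L^k)³`** (`0 < L`): a scale-`k` big block fills at least the weight's fraction of a level-`(k+1)` block. [cite: Balaban1985UV3, (24) p.262] -/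
theorem volWeight_mul_pow_le {L M₁ : ℕ} (hL : 0 < L) (k : ℕ) :
    volWeight L M₁ * (L : ℝ) ^ (3 * (k + 1)) ≤ (M₁ : ℝ) ^ 3 * ((L : ℝ) ^ k) ^ 3 := by
  have hL' : (0 : ℝ) < L := by exact_mod_cast hL
  have hpow : (0 : ℝ) ≤ (L : ℝ) ^ (3 * (k + 1)) := by positivity
  refine (mul_le_mul_of_nonneg_right (volWeight_le_ratio L M₁) hpow).trans (le_of_eq ?_)
  rw [div_pow, show 3 * (k + 1) = 3 + k * 3 by ring, pow_add, pow_mul, div_mul_eq_mul_div]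
  field_simp

/-! ## §2 A `domSet` has at least the weighted volume of a block -/

variable {𝔠 : AlphaConsts F.L (suGroupModel 2).N} {γ : ℝ} {hγ : 0 < γ} {hγ1 : γ ≤ (min 𝔠.gamma0 1) ^ 2}

/-- **A `domSet` CONTAINS A WHOLE BIG BLOCK, HENCE `≥ volWeight·L^{3(k+1)}` FINE SITES** for a domain at step `k` of run `K` with `k + 1 ≤ m + K`, NO condition
on `M₁`: the big block of any label `b ∈ X.1` consists of `M₁³` level-`k` sites if `M₁ ≤ S_k` (no wrap-around), of ALL `S_k³` sites if `S_k < M₁`; each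
level-`k` site carries `(L^k)³` fine sites (g0's `pow_le_sum_indicator_domSet` with the letter `L ≤ M₁` replaced by the weight). [cite: Balaban1985UV3, (24) p.262, (39) p.266, (59) p.270] -/
theorem volWeight_mul_pow_le_sum_indicator_domSet (K k : ℕ) (hk : k + 1 ≤ F.m + K)
    (X : (tsys 3 (nblkOf (SK F 𝔠 γ hγ hγ1 K) 𝔠.lane.carrier k)).Dom) :
    volWeight F.L 𝔠.M₁ * (F.L : ℝ) ^ (3 * (k + 1)) ≤
      ∑ x : Site (F.P K) 0, (domSet (F := F) 𝔠.lane.carrier.M₁ K k X).indicator (fun _ => (1 : ℝ)) x := by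
  classical
  obtain ⟨b, hb⟩ := X.2.1
  have hM0 : 0 < 𝔠.M₁ := 𝔠.M₁_pos
  have hL0 : 0 < F.L := by have := F.hL.2; omega
  rw [sum_indicator_eq_card]
  by_cases hcase : 𝔠.M₁ ≤ (F.P K).sitesPerDir k
  · -- no wrap-around: the big block `b` has `M₁³` level-`k` sites
    have hN : nblkOf (SK F 𝔠 γ hγ hγ1 K) 𝔠.lane.carrier k = (F.P K).sitesPerDir k / 𝔠.M₁ := by
      rw [nblkOf_SK]; exact max_eq_right (Nat.div_pos hcase hM0)
    have ht : ∀ μ, (b μ).val * 𝔠.M₁ + 𝔠.M₁ ≤ (F.P K).sitesPerDir k := fun μ => by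
      have h1 : (b μ).val < (F.P K).sitesPerDir k / 𝔠.M₁ := lt_of_lt_of_eq (ZMod.val_lt (b μ)) hN
      calc (b μ).val * 𝔠.M₁ + 𝔠.M₁ = ((b μ).val + 1) * 𝔠.M₁ := by ring
        _ ≤ ((F.P K).sitesPerDir k / 𝔠.M₁) * 𝔠.M₁ := Nat.mul_le_mul_right _ h1
        _ ≤ (F.P K).sitesPerDir k := Nat.div_mul_le_self _ _
    set Z : Finset (Site (F.P K) k) := univ.image (offSite F K k 𝔠.M₁ (fun μ => (b μ).val) (w := 𝔠.M₁)) with hZ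
    have hZcard : Z.card = 𝔠.M₁ ^ 3 := by
      rw [hZ, card_image_of_injective _ (offSite_injective K k 𝔠.M₁ _ ht), card_univ, Fintype.card_fun, Fintype.card_fin, Fintype.card_fin]
    have hsub : (univ.filter fun x : Site (F.P K) 0 => coarsen k x ∈ Z) ⊆
        univ.filter fun x => x ∈ domSet (F := F) 𝔠.lane.carrier.M₁ K k X := by
      intro x hx
      rw [mem_filter] at hx ⊢
      obtain ⟨r, -, hr⟩ := mem_image.mp hx.2
      refine ⟨hx.1, ?_⟩
      simp only [domSet, Set.mem_setOf_eq]
      refine ⟨b, hb, funext fun μ => ?_⟩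
      show ((coarsen k x) μ).val / 𝔠.M₁ = (b μ).val
      rw [← hr]
      exact bigLabel_offSite K k 𝔠.M₁ hM0 _ r μ (ht μ)
    calc volWeight F.L 𝔠.M₁ * (F.L : ℝ) ^ (3 * (k + 1)) ≤ (𝔠.M₁ : ℝ) ^ 3 * ((F.L : ℝ) ^ k) ^ 3 := volWeight_mul_pow_le hL0 k
      _ = ((𝔠.M₁ ^ 3 * ((F.P K).L ^ k) ^ 3 : ℕ) : ℝ) := by push_cast; rfl
      _ = ((univ.filter fun x : Site (F.P K) 0 => coarsen k x ∈ Z).card : ℝ) := by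
          rw [card_filter_coarsen_mem K k (by omega) Z, hZcard]
      _ ≤ ((univ.filter fun x : Site (F.P K) 0 => x ∈ domSet (F := F) 𝔠.lane.carrier.M₁ K k X).card : ℝ) := by
          exact_mod_cast card_le_card hsub
  · -- small torus: one big block, every fine site lies in it
    rw [not_le] at hcase
    have hN : nblkOf (SK F 𝔠 γ hγ hγ1 K) 𝔠.lane.carrier k = 1 := by
      rw [nblkOf_SK, Nat.div_eq_of_lt hcase]; rfl
    have hall : (univ.filter fun x : Site (F.P K) 0 => x ∈ domSet (F := F) 𝔠.lane.carrier.M₁ K k X) = univ := by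
      refine Finset.filter_true_of_mem fun x _ => ?_
      simp only [domSet, Set.mem_setOf_eq]
      refine ⟨b, hb, funext fun μ => ?_⟩
      have h1 : ((coarsen k x) μ).val < 𝔠.M₁ := lt_trans (ZMod.val_lt _) hcase
      have h2 : (b μ).val = 0 := by have := lt_of_lt_of_eq (ZMod.val_lt (b μ)) hN; omega
      show ((coarsen k x) μ).val / 𝔠.M₁ = (b μ).val
      rw [h2]
      exact Nat.div_eq_of_lt h1
    rw [hall, card_univ, LogComparisonPolymerBudget.card_site_zero]
    have hL1 : (1 : ℝ) ≤ F.L := by exact_mod_cast F.hL.2.le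
    have hx0 : (0 : ℝ) ≤ (F.L : ℝ) ^ (3 * (F.m + K)) := by positivity
    have hx1 : (0 : ℝ) ≤ (F.L : ℝ) ^ (3 * (k + 1)) := by positivity
    calc volWeight F.L 𝔠.M₁ * (F.L : ℝ) ^ (3 * (k + 1)) ≤ 1 * (F.L : ℝ) ^ (3 * (k + 1)) :=
          mul_le_mul_of_nonneg_right (volWeight_le_one _ _) hx1
      _ = (F.L : ℝ) ^ (3 * (k + 1)) := one_mul _
      _ ≤ (F.L : ℝ) ^ (3 * (F.m + K)) := pow_le_pow_right₀ hL1 (by omega)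
      _ ≤ 8 * (F.L : ℝ) ^ (3 * (F.m + K)) := by linarith

/-! ## §3 The weighted volume row for the canonical polymerisation — every v3 family, no letter -/

/-- **THE `volWeight`-WEIGHTED BLOCK VOLUME FOR THE CANONICAL POLYMERISATION OF EVERY v3 FAMILY, NO CONDITION ON `M₁`**: every listed level-`i` domain `Y` of
`dataOfV3 p (canonPolymer p)` has `volWeight L M₁ · L^{3i} ≤ #Y` — blocks exactly `L^{3i}`, the dummy whole-torus domain `8L^{3(m+K)} ≥ L³`, new-term domains a
whole big block (§2); `volWeight ≤ 1` covers the first two.  This is `GlobalSlackLocalToGlobalCount.LocBlockVolumeC (dataOfV3 p (canonPolymer p)) (volWeight L M₁)`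
unfolded (producer row 3 in count form, discharged for every constants record). [cite: Balaban1985UV3, (24) p.262, (45)-(46) p.267] -/
theorem volWeight_mul_pow_le_sum_indicator_canon (p : ∀ K, AlphaInputsT3AC.PkgAtV3 F 𝔠 γ hγ hγ1 K) (K j : ℕ)
    (h : (AlphaInputsT3AC.dataOfV3 p (canonPolymer p)).Hist K j) (i : ℕ) (Y : Set (Site (F.P K) 0))
    (hY : Y ∈ (AlphaInputsT3AC.dataOfV3 p (canonPolymer p)).Loc K j h i) :
    volWeight F.L 𝔠.M₁ * (F.L : ℝ) ^ (3 * i) ≤ ∑ y : Site (F.P K) 0, Y.indicator (fun _ => (1 : ℝ)) y := by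
  classical
  have hw1 : volWeight F.L 𝔠.M₁ ≤ 1 := volWeight_le_one _ _
  have hweak : ∀ {i : ℕ} {v : ℝ}, (F.L : ℝ) ^ (3 * i) ≤ v → volWeight F.L 𝔠.M₁ * (F.L : ℝ) ^ (3 * i) ≤ v := fun {i v} hv =>
    ((mul_le_mul_of_nonneg_right hw1 (by positivity)).trans_eq (one_mul _)).trans hv
  change Y ∈ canonLoc p K j h i at hY
  cases j with
  | zero => simp [canonLoc] at hY
  | succ k =>
    by_cases hk : k + 1 ≤ K
    · by_cases hik : i = k + 1
      · subst hik
        simp only [canonLoc, if_pos hk, ite_true, mem_image] at hY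
        obtain ⟨X, -, rfl⟩ := hY
        exact volWeight_mul_pow_le_sum_indicator_domSet K k (by have := F.hm; omega) X
      · by_cases hi : i ∈ Finset.Icc 1 k
        · simp only [canonLoc, if_pos hk, if_neg hik, if_pos hi, mem_image] at hY
          obtain ⟨y, -, rfl⟩ := hY
          have hik' : i ≤ F.m + K := by have := (Finset.mem_Icc.mp hi).2; have := F.hm; omega
          exact hweak (le_of_eq (sum_indicator_blockSet K i hik' y).symm)
        · simp only [canonLoc, if_pos hk, if_neg hik, if_neg hi] at hY
          simp at hY
    · by_cases hi1 : i = 1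
      · subst hi1
        simp only [canonLoc, if_neg hk, ite_true, mem_singleton] at hY
        subst hY
        refine hweak ?_
        rw [sum_indicator_eq_card, Finset.filter_true_of_mem (fun x _ => Set.mem_univ x), card_univ,
          LogComparisonPolymerBudget.card_site_zero]
        have hL1 : (1 : ℝ) ≤ F.L := by exact_mod_cast F.hL.2.le
        have hx0 : (0 : ℝ) ≤ (F.L : ℝ) ^ (3 * (F.m + K)) := by positivity
        calc (F.L : ℝ) ^ (3 * 1) ≤ (F.L : ℝ) ^ (3 * (F.m + K)) := pow_le_pow_right₀ hL1 (by have := F.hm; omega)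
          _ ≤ 8 * (F.L : ℝ) ^ (3 * (F.m + K)) := by linarith
      · simp only [canonLoc, if_neg hk, if_neg hi1] at hY
        simp at hY

/-- The weight of the canonical polymerisation's volume row is positive (`L > 1`, `M₁ > 0` from the family and the record). [cite: Balaban1985UV3, (24) p.262] -/
theorem volWeight_canon_pos (𝔠 : AlphaConsts F.L (suGroupModel 2).N) : 0 < volWeight F.L 𝔠.M₁ :=
  volWeight_pos (by have := F.hL.2; omega) 𝔠.M₁_pos

end Summit.QuantumFields.YangMills.Theorems.GlobalSlackCanonicalPolymers

end
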